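import Literature.Computability.AlgebraicComplexity.AndrewsForbes2022DeterminantalIdeals
import Literature.Computability.AlgebraicComplexity.BideterminantReductionProofs

/-!
# Andrews–Forbes 2022, Theorem 3.8 — PROVED (`AndrewsForbes2022_thm_3_8_holds`)

Discharge of the named fact `AndrewsForbes2022_thm_3_8` (the LOAD-BEARING statement of the val-lit
row AndrewsForbes2022-A, file `AndrewsForbes2022DeterminantalIdeals.lean`): every nonzero
`f ∈ I^det_{n,m,r}` is as border-hard as any `r`-vertex layered ABP for depth-three single-oracle
reductions (characteristic zero bullet), [cite: AndrewsForbes2022, Thm. 3.8].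

The proof FOLLOWS THE PRINTED PROOF (p0023:L59–p0024:L45) and assembles three results that are
already theorems of the tree:
* Prop. 3.5 (`AndrewsForbes2022_prop_3_5_holds`, `BideterminantReductionProofs.lean`): a border
  change of variables `ℓ` with `f(ℓ) = ε^q α (K_σ | K_σ)(X) + O(ε^{q+1})`, `σ₁ ≥ r`;
* Lemma 3.7 (`AndrewsForbes2022_lemma_3_7_holds`): homogenisation `ĝ(y, z)` of the ABP;
* Lemma 3.6 (`AndrewsForbes2022_lemma_3_6_holds`): an `r × r` matrix `A(y, z)` of affine forms
  with `det A = 1 + ĝ` and unit leading principal minors.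
Then (`Theorem38.*`): `(K_σ | K_σ)(A ⊕ I) = (1 + ĝ)^t` with `t = #{i : σᵢ ≥ r} ≥ 1`
(`bind₁_kBideterminant_extMat`); the old `ε` is replaced by `ε^{D+1}` (`D = deg ĝ ≥ 1`; on
`F((ε))` this is the tree's `epsPow`, on `F(ε)` it is `ratFuncExpand` = `RatFunc.map` of
`Polynomial.expand`, and the two agree: `coe_ratFuncExpand`), the substitution `y ↦ ε y`, `z ↦ ε`
scales the homogeneous `ĝ` by `ε^D` (`bind₁_C_mul_of_isHomogeneous`), the binomial expansion
`(1 + x)^t = 1 + t x + x² W(x)` (`add_pow_eq_remainder`) isolates `ε^{Q+D} α t · g(y)` with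
`Q = (D+1) q`, and the top gate `w ↦ (w - ε^Q α)/(ε^{Q+D} α t)` leaves `g + O(ε)`; finally the exact
`f`-oracle is replaced by the `h(·, ε^{N+1})`-oracle (Lemma 2.3 / 3.4 of the paper) using the
order calculus with poles `PolyOrdGE.bind₁_of_totalDegree_le` and `N` large.  The constant case
`D = 0` is the trivial circuit; `r = 0` and `r > min(n, m)` are vacuous.

Honest framing: a discharge of typed literature (net debt −1); VP ≠ VNP is NOT proved and nothing
here is progress on it.

## References
* [AndrewsForbes2022] R. Andrews, M. A. Forbes, *Ideals, determinants, and straightening: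
  proving and using lower bounds for polynomial ideals*, STOC 2022, arXiv:2112.00792 — Thm. 3.8
  (proof p. 23–24), Lemma 2.3, Prop. 3.5, Lemmas 3.6–3.7.
-/

noncomputable section

open MvPolynomial Matrix
open scoped RatFunc LaurentSeries Polynomial

namespace Literature.Computability.AlgebraicComplexity

namespace Theorem38


variable {F : Type*} [Field F]

/-! #### `ε ↦ ε^{N+1}` and orders -/

/-- Proof step of Thm. 3.8 (`coeff_epsPow_mul`). [cite: AndrewsForbes2022, Thm. 3.8 (proof)] -/
theorem coeff_epsPow_mul (N : ℕ) (x : LaurentSeries F) (i : ℤ) :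
    (epsPow F N x).coeff (((N : ℤ) + 1) * i) = x.coeff i := by
  rw [epsPow, HahnSeries.embDomainRingHom_apply]
  exact HahnSeries.embDomain_coeff (a := i)

/-- Proof step of Thm. 3.8 (`coeff_epsPow_eq_zero`). [cite: AndrewsForbes2022, Thm. 3.8 (proof)] -/
theorem coeff_epsPow_eq_zero (N : ℕ) (x : LaurentSeries F) {j : ℤ}
    (hj : ∀ i, j ≠ ((N : ℤ) + 1) * i) : (epsPow F N x).coeff j = 0 := by
  rw [epsPow, HahnSeries.embDomainRingHom_apply]
  refine HahnSeries.embDomain_notin_range ?_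
  rintro ⟨i, rfl⟩
  exact hj i rfl

/-- `ε ↦ ε^{N+1}` multiplies orders by `N + 1`. [cite: AndrewsForbes2022, Thm. 3.8 (proof)] -/
theorem _root_.Literature.Computability.AlgebraicComplexity.IsOrdGE.epsPow (N : ℕ) {k : ℤ}
    {x : LaurentSeries F} (hx : IsOrdGE k x) : IsOrdGE (((N : ℤ) + 1) * k) (epsPow F N x) := by
  intro j hj
  by_cases h : ∃ i, j = ((N : ℤ) + 1) * i
  · obtain ⟨i, rfl⟩ := h
    rw [coeff_epsPow_mul]
    refine hx i ?_
    by_contra hle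
    push Not at hle
    have : ((N : ℤ) + 1) * k ≤ ((N : ℤ) + 1) * i := mul_le_mul_of_nonneg_left hle (by positivity)
    omega
  · push Not at h
    exact coeff_epsPow_eq_zero N x h

/-- Proof step of Thm. 3.8 (`map_epsPow`). [cite: AndrewsForbes2022, Thm. 3.8 (proof)] -/
theorem _root_.Literature.Computability.AlgebraicComplexity.PolyOrdGE.map_epsPow {σ : Type*}
    (N : ℕ) {k : ℤ} {p : MvPolynomial σ (LaurentSeries F)} (hp : PolyOrdGE k p) :
    PolyOrdGE (((N : ℤ) + 1) * k) (MvPolynomial.map (epsPow F N) p) := fun e => by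
  rw [coeff_map]
  exact (hp e).epsPow N

/-- Proof step of Thm. 3.8 (`epsPow_comp_algebraMap`). [cite: AndrewsForbes2022, Thm. 3.8 (proof)] -/
theorem epsPow_comp_algebraMap (N : ℕ) :
    (epsPow F N).comp (algebraMap F (LaurentSeries F)) = algebraMap F (LaurentSeries F) := by
  refine RingHom.ext fun a => ?_
  rw [RingHom.comp_apply, algebraMap_laurentSeries_apply, epsPow_C]

/-- Proof step of Thm. 3.8 (`map_epsPow_map_algebraMap`). [cite: AndrewsForbes2022, Thm. 3.8 (proof)] -/
theorem map_epsPow_map_algebraMap {σ : Type*} (N : ℕ) (p : MvPolynomial σ F) :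
    MvPolynomial.map (epsPow F N) (MvPolynomial.map (algebraMap F (LaurentSeries F)) p) =
      MvPolynomial.map (algebraMap F (LaurentSeries F)) p := by
  rw [MvPolynomial.map_map, epsPow_comp_algebraMap]

/-! #### Substitution of polynomials with poles of bounded order -/

/-- A power of an `O(ε^{-e})` polynomial. [cite: AndrewsForbes2022, Thm. 3.8 (proof)] -/
theorem _root_.Literature.Computability.AlgebraicComplexity.PolyOrdGE.pow_neg {σ : Type*} {e : ℕ}
    {p : MvPolynomial σ (LaurentSeries F)} (hp : PolyOrdGE (-(e : ℤ)) p) (n : ℕ) :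
    PolyOrdGE (-((e * n : ℕ) : ℤ)) (p ^ n) := by
  induction n with
  | zero => simpa using PolyOrdGE.one
  | succ n ih =>
    rw [pow_succ]
    have := ih.mul hp
    convert this using 1
    push_cast; ring

/-- **Substitution with poles**: if every `θ i` is `O(ε^{-e})` and `p` is `O(ε^k)` of total degree
`≤ D`, then `p(θ)` is `O(ε^{k - eD})`. [cite: AndrewsForbes2022, Thm. 3.8 (proof)] -/
theorem _root_.Literature.Computability.AlgebraicComplexity.PolyOrdGE.bind₁_of_totalDegree_le
    {σ τ : Type*} {k : ℤ} {e D : ℕ} {p : MvPolynomial σ (LaurentSeries F)} (hp : PolyOrdGE k p)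
    (hD : p.totalDegree ≤ D) {θ : σ → MvPolynomial τ (LaurentSeries F)}
    (hθ : ∀ i, PolyOrdGE (-(e : ℤ)) (θ i)) :
    PolyOrdGE (k - ((e * D : ℕ) : ℤ)) (MvPolynomial.bind₁ θ p) := by
  classical
  rw [p.as_sum, map_sum]
  refine PolyOrdGE.sum fun d hd => ?_
  rw [bind₁_monomial]
  have hdeg : d.sum (fun _ n => n) ≤ D := (le_totalDegree hd).trans hD
  -- the product of the powers is `O(ε^{-e Σ dᵢ})`
  have hprod : PolyOrdGE (-((e * d.sum (fun _ n => n) : ℕ) : ℤ))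
      (d.prod fun i n => θ i ^ n) := by
    unfold Finsupp.prod Finsupp.sum
    induction d.support using Finset.induction_on with
    | empty => simpa using PolyOrdGE.one
    | insert a s ha ih =>
      rw [Finset.prod_insert ha, Finset.sum_insert ha]
      have := ((hθ a).pow_neg (d a)).mul ih
      convert this using 1
      push_cast; ring
  have := (PolyOrdGE.C (hp d)).mul hprod
  refine this.mono ?_
  have : (e * d.sum (fun _ n => n) : ℕ) ≤ e * D := Nat.mul_le_mul_left e hdeg
  omega

/-! #### Homogeneous scaling and the binomial remainder -/

/-- Scaling the variables of a homogeneous polynomial of degree `D` by `c` multiplies it by `c^D`. [cite: AndrewsForbes2022, Thm. 3.8 (proof)] -/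
theorem bind₁_C_mul_of_isHomogeneous {R : Type*} [CommSemiring R] {σ τ : Type*}
    {φ : MvPolynomial σ R} {D : ℕ} (hφ : φ.IsHomogeneous D) (c : R) (θ : σ → MvPolynomial τ R) :
    MvPolynomial.bind₁ (fun i => C c * θ i) φ = C (c ^ D) * MvPolynomial.bind₁ θ φ := by
  classical
  conv_lhs => rw [φ.as_sum]
  conv_rhs => rw [φ.as_sum]
  rw [map_sum, map_sum, Finset.mul_sum]
  refine Finset.sum_congr rfl fun d hd => ?_
  rw [bind₁_monomial, bind₁_monomial]
  have hdeg : d.sum (fun _ n => n) = D := by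
    have := hφ (mem_support_iff.mp hd)
    simpa [Finsupp.weight_apply, Finsupp.sum] using this
  rw [← hdeg]
  simp only [Finsupp.sum]
  rw [Finset.prod_congr rfl fun i _ => mul_pow (C c) (θ i) (d i), Finset.prod_mul_distrib,
    Finset.prod_pow_eq_pow_sum, ← map_pow]
  ring

/-- `(1 + x)^t = 1 + t x + x² W` with `W` a polynomial in `x` with natural coefficients. [cite: AndrewsForbes2022, Thm. 3.8 (proof)] -/
theorem add_pow_eq_remainder {A : Type*} [CommSemiring A] (x : A) (t : ℕ) :
    ∃ W : Polynomial ℕ, (1 + x) ^ t = 1 + (t : A) * x + x ^ 2 * (W.map (Nat.castRingHom A)).eval x := by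
  induction t with
  | zero => exact ⟨0, by simp⟩
  | succ t ih =>
    obtain ⟨W, hW⟩ := ih
    refine ⟨W + Polynomial.C t + Polynomial.X * W, ?_⟩
    rw [pow_succ, hW]
    simp only [Polynomial.map_add, Polynomial.map_mul, Polynomial.map_X, Polynomial.map_natCast,
      Polynomial.eval_add, Polynomial.eval_mul, Polynomial.eval_X, Polynomial.eval_natCast,
      eq_natCast, Nat.cast_succ]
    ring


section PartC

variable {F : Type*} [Field F]


/-! #### `ε ↦ ε^{N+1}` on `F[ε]` and `F(ε)`, compatibly with `epsPow` on `F((ε))` -/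

/-- On polynomials, `ε ↦ ε^{N+1}` is `Polynomial.expand`. [cite: AndrewsForbes2022, Thm. 3.8 (proof)] -/
theorem algebraMap_expand (N : ℕ) (p : F[X]) :
    algebraMap F[X] (LaurentSeries F) (Polynomial.expand F (N + 1) p) =
      epsPow F N (algebraMap F[X] (LaurentSeries F) p) := by
  have : (algebraMap F[X] (LaurentSeries F)).comp (Polynomial.expand F (N + 1) : F[X] →ₐ[F] F[X]).toRingHom =
      (epsPow F N).comp (algebraMap F[X] (LaurentSeries F)) := by
    refine Polynomial.ringHom_ext (fun a => ?_) ?_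
    · simp only [RingHom.coe_comp, RingHom.coe_coe, Function.comp_apply, AlgHom.toRingHom_eq_coe,
        Polynomial.expand_C]
      rw [Polynomial.algebraMap_hahnSeries_apply, Polynomial.coe_C, HahnSeries.ofPowerSeries_C,
        epsPow_C]
    · simp only [RingHom.coe_comp, RingHom.coe_coe, Function.comp_apply, AlgHom.toRingHom_eq_coe,
        Polynomial.expand_X, Polynomial.algebraMap_hahnSeries_apply, map_pow,
        Polynomial.coe_X, HahnSeries.ofPowerSeries_X, epsPow_single, HahnSeries.single_pow]
      simp
  exact congrArg (fun φ : F[X] →+* LaurentSeries F => φ p) this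

/-- Proof step of Thm. 3.8 (`expand_mem_nonZeroDivisors`). [cite: AndrewsForbes2022, Thm. 3.8 (proof)] -/
theorem expand_mem_nonZeroDivisors (N : ℕ) :
    nonZeroDivisors F[X] ≤ (nonZeroDivisors F[X]).comap
      ((Polynomial.expand F (N + 1) : F[X] →ₐ[F] F[X]) : F[X] →+* F[X]) := by
  intro p hp
  rw [Submonoid.mem_comap, mem_nonZeroDivisors_iff_ne_zero]
  rw [mem_nonZeroDivisors_iff_ne_zero] at hp
  simpa [Polynomial.expand_eq_zero (Nat.succ_pos N)] using hp

/-- `ε ↦ ε^{N+1}` on `F(ε)`. [cite: AndrewsForbes2022, Thm. 3.8 (proof)] -/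
def ratFuncExpand (N : ℕ) : RatFunc F →+* RatFunc F :=
  RatFunc.mapRingHom ((Polynomial.expand F (N + 1) : F[X] →ₐ[F] F[X]) : F[X] →+* F[X])
    (expand_mem_nonZeroDivisors N)

/-- Compatibility of `ε ↦ ε^{N+1}` on `F(ε)` with `epsPow` on `F((ε))`. [cite: AndrewsForbes2022, Thm. 3.8 (proof)] -/
theorem coe_ratFuncExpand (N : ℕ) (g : RatFunc F) :
    ((ratFuncExpand N g : RatFunc F) : LaurentSeries F) = epsPow F N (g : LaurentSeries F) := by
  induction g using RatFunc.induction_on with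
  | f p q hq =>
    have h1 : ratFuncExpand N (algebraMap F[X] (RatFunc F) p / algebraMap F[X] (RatFunc F) q) =
        algebraMap F[X] (RatFunc F) (Polynomial.expand F (N + 1) p) /
          algebraMap F[X] (RatFunc F) (Polynomial.expand F (N + 1) q) := by
      show RatFunc.map ((Polynomial.expand F (N + 1) : F[X] →ₐ[F] F[X]) : F[X] →+* F[X])
        (expand_mem_nonZeroDivisors N) _ = _
      rw [RatFunc.map_apply_div]
      rfl
    rw [h1]
    change algebraMap (RatFunc F) (LaurentSeries F) _ =
      epsPow F N (algebraMap (RatFunc F) (LaurentSeries F) _)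
    rw [RatFunc.algebraMap_apply_div, RatFunc.algebraMap_apply_div, map_div₀, algebraMap_expand,
      algebraMap_expand]

/-- `ε ↦ ε^{N+1}` multiplies the order of vanishing by `N + 1`. [cite: AndrewsForbes2022, Thm. 3.8 (proof)] -/
theorem isBigOEps_ratFuncExpand (N : ℕ) {k : ℤ} {g : RatFunc F} (hg : IsBigOEps F k g) :
    IsBigOEps F (((N : ℤ) + 1) * k) (ratFuncExpand N g) := by
  rw [isBigOEps_iff_isOrdGE] at hg ⊢
  rw [coe_ratFuncExpand]
  exact hg.epsPow N

/-! #### Polynomials in `ε` are their constant term `+ O(ε)` -/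

/-- Proof step of Thm. 3.8 (`isOrdGE_one_algebraMap_sub_C`). [cite: AndrewsForbes2022, Thm. 3.8 (proof)] -/
theorem isOrdGE_one_algebraMap_sub_C (p : F[X]) :
    IsOrdGE 1 (algebraMap F[X] (LaurentSeries F) p - HahnSeries.C (p.coeff 0)) := by
  intro i hi
  rw [Polynomial.algebraMap_hahnSeries_apply, HahnSeries.coeff_sub]
  change ((p : PowerSeries F) : LaurentSeries F).coeff i - _ = 0
  rw [PowerSeries.coeff_coe]
  by_cases h0 : i = 0
  · subst h0
    simp [Polynomial.coeff_coe]
  · rw [if_pos (by omega), HahnSeries.C_apply, HahnSeries.coeff_single_of_ne h0, sub_zero]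

/-- `g̃ ∈ F[ε][y]` is its constant-in-`ε` part `+ O(ε)` (how `g̃ = g + O(ε)` is read). [cite: AndrewsForbes2022, Thm. 3.8 (proof)] -/
theorem polyOrdGE_one_map_polynomial_sub {ι : Type*} (g' : MvPolynomial ι F[X]) :
    PolyOrdGE 1 (MvPolynomial.map (algebraMap F[X] (LaurentSeries F)) g' -
      MvPolynomial.map (algebraMap F (LaurentSeries F))
        (MvPolynomial.map (Polynomial.constantCoeff : F[X] →+* F) g')) := by
  intro e
  rw [MvPolynomial.coeff_sub, MvPolynomial.coeff_map, MvPolynomial.coeff_map,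
    MvPolynomial.coeff_map, algebraMap_laurentSeries_apply, Polynomial.constantCoeff_apply]
  exact isOrdGE_one_algebraMap_sub_C _


end PartC


/-! #### The bideterminant `(K_σ | K_σ)` at the matrix `A ⊕ I` -/

section ExtMat

variable {S : Type*} [CommRing S] {r n m : ℕ}

/-- "Extend `A(y,z)` to an `n × m` matrix by adding ones along the main diagonal and zeroes
elsewhere" (p0023:L72). [cite: AndrewsForbes2022, Thm. 3.8 (proof)] -/
def extMat (A : Matrix (Fin r) (Fin r) S) (n m : ℕ) : Matrix (Fin n) (Fin m) S :=
  Matrix.of fun i j =>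
    if h : (i : ℕ) < r ∧ (j : ℕ) < r then A ⟨i, h.1⟩ ⟨j, h.2⟩ else if (i : ℕ) = j then 1 else 0

/-- Proof step of Thm. 3.8 (`extMat_apply`). [cite: AndrewsForbes2022, Thm. 3.8 (proof)] -/
theorem extMat_apply (A : Matrix (Fin r) (Fin r) S) (i : Fin n) (j : Fin m) :
    extMat A n m i j =
      if h : (i : ℕ) < r ∧ (j : ℕ) < r then A ⟨i, h.1⟩ ⟨j, h.2⟩
      else if (i : ℕ) = j then 1 else 0 := rfl

/-- Leading blocks of size `s ≤ r` of the extended matrix are those of `A`. [cite: AndrewsForbes2022, Thm. 3.8 (proof)] -/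
theorem extMat_submatrix_of_le (A : Matrix (Fin r) (Fin r) S) {s : ℕ} (hs : s ≤ r) (hn : s ≤ n)
    (hm : s ≤ m) :
    (extMat A n m).submatrix (Fin.castLE hn) (Fin.castLE hm) =
      A.submatrix (Fin.castLE hs) (Fin.castLE hs) := by
  ext i j
  have h : ((Fin.castLE hn i : Fin n) : ℕ) < r ∧ ((Fin.castLE hm j : Fin m) : ℕ) < r := by
    simp only [Fin.val_castLE]; omega
  rw [submatrix_apply, submatrix_apply, extMat_apply, dif_pos h]
  rfl

/-- Leading blocks of size `s ≥ r` of the extended matrix are `A ⊕ I`. [cite: AndrewsForbes2022, Thm. 3.8 (proof)] -/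
theorem extMat_submatrix_of_ge (A : Matrix (Fin r) (Fin r) S) {s : ℕ} (hs : r ≤ s) (hn : s ≤ n)
    (hm : s ≤ m) :
    (extMat A n m).submatrix (Fin.castLE hn) (Fin.castLE hm) =
      Matrix.reindex (finSumFinEquiv.trans (finCongr (Nat.add_sub_cancel' hs)))
        (finSumFinEquiv.trans (finCongr (Nat.add_sub_cancel' hs)))
        (Matrix.fromBlocks A 0 0 (1 : Matrix (Fin (s - r)) (Fin (s - r)) S)) := by
  ext i j
  obtain ⟨x, rfl⟩ := (finSumFinEquiv.trans (finCongr (Nat.add_sub_cancel' hs))).surjective i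
  obtain ⟨y, rfl⟩ := (finSumFinEquiv.trans (finCongr (Nat.add_sub_cancel' hs))).surjective j
  rw [reindex_apply, submatrix_apply, submatrix_apply, Equiv.symm_apply_apply,
    Equiv.symm_apply_apply, extMat_apply]
  rcases x with a | a <;> rcases y with b | b <;>
    simp [Fin.val_castLE, finSumFinEquiv_apply_left, finSumFinEquiv_apply_right, Fin.ext_iff,
      Matrix.one_apply] <;> omega

/-- Proof step of Thm. 3.8 (`det_extMat_submatrix_of_ge`). [cite: AndrewsForbes2022, Thm. 3.8 (proof)] -/
theorem det_extMat_submatrix_of_ge (A : Matrix (Fin r) (Fin r) S) {s : ℕ} (hs : r ≤ s)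
    (hn : s ≤ n) (hm : s ≤ m) :
    ((extMat A n m).submatrix (Fin.castLE hn) (Fin.castLE hm)).det = A.det := by
  rw [extMat_submatrix_of_ge A hs hn hm, det_reindex_self, det_fromBlocks_zero₂₁, det_one, mul_one]

end ExtMat

section Bidet

variable {L : Type*} [Field L] {τ : Type*} {n m : ℕ}

/-- Evaluating the leading minor `det X_{[s],[s]}` at a matrix of polynomials gives the
determinant of its leading block. [cite: AndrewsForbes2022, Thm. 3.8 (proof)] -/
theorem bind₁_leadingMinor (M : Matrix (Fin n) (Fin m) (MvPolynomial τ L)) {s : ℕ} (hn : s ≤ n)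
    (hm : s ≤ m) :
    MvPolynomial.bind₁ (fun kl : Fin n × Fin m => M kl.1 kl.2) (leadingMinor L n m s) =
      (M.submatrix (Fin.castLE hn) (Fin.castLE hm)).det := by
  rw [leadingMinor_of_le hn hm, AlgHom.map_det, AlgHom.mapMatrix_apply, ← submatrix_map]
  congr 1
  have : (mvPolynomialX (Fin n) (Fin m) L).map
      (MvPolynomial.bind₁ fun kl : Fin n × Fin m => M kl.1 kl.2) = M := by
    ext i j
    rw [Matrix.map_apply, mvPolynomialX_apply, bind₁_X_right]
  rw [this]

/-- `(K_σ | K_σ)` evaluated at `A ⊕ I`, where `A` is `r × r` with unit leading principal minors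
below `r`, is `(det A)^t`, `t = #{i : σᵢ ≥ r}` (the computation on p0023:L74–L78). [cite: AndrewsForbes2022, Thm. 3.8 (proof)] -/
theorem bind₁_kBideterminant_extMat {r : ℕ} (A : Matrix (Fin r) (Fin r) (MvPolynomial τ L))
    (hA : ∀ (k : ℕ) (hk : k < r), (A.submatrix (Fin.castLE hk.le) (Fin.castLE hk.le)).det = 1)
    (σ : Multiset ℕ) (hσ : ∀ s ∈ σ, 0 < s ∧ s ≤ min n m) :
    MvPolynomial.bind₁ (fun kl : Fin n × Fin m => extMat A n m kl.1 kl.2) (kBideterminant L n m σ) =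
      A.det ^ Multiset.card (σ.filter fun s => r ≤ s) := by
  induction σ using Multiset.induction_on with
  | empty => simp
  | cons s σ ih =>
    have hs := hσ s (Multiset.mem_cons_self s σ)
    have hsn : s ≤ n := hs.2.trans (min_le_left n m)
    have hsm : s ≤ m := hs.2.trans (min_le_right n m)
    rw [kBideterminant_cons, map_mul, ih fun s' hs' => hσ s' (Multiset.mem_cons_of_mem hs'),
      bind₁_leadingMinor _ hsn hsm, Multiset.filter_cons]
    by_cases hrs : r ≤ s
    · rw [if_pos hrs, det_extMat_submatrix_of_ge A hrs hsn hsm, Multiset.singleton_add,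
        Multiset.card_cons, pow_succ, mul_comm]
    · rw [if_neg hrs, zero_add, extMat_submatrix_of_le A (Nat.le_of_not_le hrs) hsn hsm,
        hA s (Nat.lt_of_not_le hrs), one_mul]

end Bidet


/-! #### Small helpers for the assembly -/

section Helpers

variable {F : Type*} [Field F]

/-- Proof step of Thm. 3.8 (`detIdeal_eq_bot`). [cite: AndrewsForbes2022, Thm. 3.8 (proof)] -/
theorem detIdeal_eq_bot {n m r : ℕ} (h : ¬ (r ≤ n ∧ r ≤ m)) : detIdeal F n m r = ⊥ := by
  rw [detIdeal, Ideal.span_eq_bot]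
  rintro p ⟨ρ, γ, rfl⟩
  rcases not_and_or.mp h with hn | hm
  · obtain ⟨i, j, hij, hρ⟩ := Fintype.exists_ne_map_eq_of_card_lt ρ (by simpa using Nat.lt_of_not_le hn)
    exact Matrix.det_zero_of_row_eq hij (funext fun k => by simp [Matrix.submatrix_apply, hρ])
  · obtain ⟨i, j, hij, hγ⟩ := Fintype.exists_ne_map_eq_of_card_lt γ (by simpa using Nat.lt_of_not_le hm)
    rw [← Matrix.det_transpose]
    exact Matrix.det_zero_of_row_eq hij (funext fun k => by simp [Matrix.submatrix_apply, hγ])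

/-- Proof step of Thm. 3.8 (`not_layeredABPComputes_zero`). [cite: AndrewsForbes2022, Thm. 3.8 (proof)] -/
theorem not_layeredABPComputes_zero {R : Type*} [CommSemiring R] {ι : Type*} (g : MvPolynomial ι R) :
    ¬ LayeredABPComputes 0 g := by
  rintro ⟨k, hk, layer, s, t, N, -, -, -⟩
  obtain rfl : k = 0 := Nat.le_zero.mp hk
  exact Fin.elim0 s

/-- Proof step of Thm. 3.8 (`map_leadingMinor`). [cite: AndrewsForbes2022, Thm. 3.8 (proof)] -/
theorem map_leadingMinor {L : Type*} [Field L] (φ : F →+* L) (n m s : ℕ) :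
    MvPolynomial.map φ (leadingMinor F n m s) = leadingMinor L n m s := by
  unfold leadingMinor
  split_ifs with h
  · rw [RingHom.map_det, RingHom.mapMatrix_apply, ← Matrix.submatrix_map]
    congr 1
    ext i j
    simp [Matrix.mvPolynomialX_apply]
  · simp

/-- Proof step of Thm. 3.8 (`map_kBideterminant`). [cite: AndrewsForbes2022, Thm. 3.8 (proof)] -/
theorem map_kBideterminant {L : Type*} [Field L] (φ : F →+* L) (n m : ℕ) (σ : Multiset ℕ) :
    MvPolynomial.map φ (kBideterminant F n m σ) = kBideterminant L n m σ := by
  unfold kBideterminant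
  rw [map_multiset_prod, Multiset.map_map]
  congr 1
  exact Multiset.map_congr rfl fun s _ => map_leadingMinor φ n m s

/-- Proof step of Thm. 3.8 (`extMat_map`). [cite: AndrewsForbes2022, Thm. 3.8 (proof)] -/
theorem extMat_map {S T : Type*} [CommRing S] [CommRing T] {r : ℕ} (f : S →+* T)
    (A : Matrix (Fin r) (Fin r) S) (n m : ℕ) :
    (extMat A n m).map f = extMat (A.map f) n m := by
  ext i j
  simp only [Matrix.map_apply, extMat_apply]
  split_ifs <;> simp

/-- Proof step of Thm. 3.8 (`polyOrdGE_zero_map_polynomial`). [cite: AndrewsForbes2022, Thm. 3.8 (proof)] -/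
theorem polyOrdGE_zero_map_polynomial {ι : Type*} (p : MvPolynomial ι F[X]) :
    PolyOrdGE 0 (MvPolynomial.map (algebraMap F[X] (LaurentSeries F)) p) := fun e => by
  rw [MvPolynomial.coeff_map, Polynomial.algebraMap_hahnSeries_apply]
  exact IsOrdGE.ofPowerSeries _

/-- Proof step of Thm. 3.8 (`polyOrdGE_zero_natCast`). [cite: AndrewsForbes2022, Thm. 3.8 (proof)] -/
theorem polyOrdGE_zero_natCast {ι : Type*} (n : ℕ) :
    PolyOrdGE 0 (n : MvPolynomial ι (LaurentSeries F)) := by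
  rw [← map_natCast (C : LaurentSeries F →+* MvPolynomial ι (LaurentSeries F)),
    ← map_natCast (HahnSeries.C : F →+* LaurentSeries F)]
  exact PolyOrdGE.C (IsOrdGE.C _)

/-- Proof step of Thm. 3.8 (`polyOrdGE_zero_eval_natPoly`). [cite: AndrewsForbes2022, Thm. 3.8 (proof)] -/
theorem polyOrdGE_zero_eval_natPoly {ι : Type*} (W : Polynomial ℕ)
    {x : MvPolynomial ι (LaurentSeries F)} (hx : PolyOrdGE 0 x) :
    PolyOrdGE 0 ((W.map (Nat.castRingHom _)).eval x) := by
  rw [Polynomial.eval_eq_sum_range]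
  refine PolyOrdGE.sum fun i _ => ?_
  rw [Polynomial.coeff_map, Nat.coe_castRingHom]
  simpa using (polyOrdGE_zero_natCast (W.coeff i)).mul (hx.pow i)

/-- Proof step of Thm. 3.8 (`totalDegree_map_le'`). [cite: AndrewsForbes2022, Thm. 3.8 (proof)] -/
theorem totalDegree_map_le' {R S : Type*} [CommSemiring R] [CommSemiring S] {ι : Type*}
    (φ : R →+* S) (p : MvPolynomial ι R) : (MvPolynomial.map φ p).totalDegree ≤ p.totalDegree := by
  classical
  rw [MvPolynomial.totalDegree, MvPolynomial.totalDegree]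
  exact Finset.sup_mono (MvPolynomial.support_map_subset φ p)

/-- Proof step of Thm. 3.8 (`totalDegree_bind₁_le_of_le_one`). [cite: AndrewsForbes2022, Thm. 3.8 (proof)] -/
theorem totalDegree_bind₁_le_of_le_one {R : Type*} [CommSemiring R] {σ τ : Type*}
    (θ : σ → MvPolynomial τ R) (hθ : ∀ i, (θ i).totalDegree ≤ 1) (p : MvPolynomial σ R) :
    (MvPolynomial.bind₁ θ p).totalDegree ≤ p.totalDegree := by
  classical
  conv_lhs => rw [p.as_sum]
  rw [map_sum]
  refine (totalDegree_finsetSum _ _).trans (Finset.sup_le fun d hd => ?_)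
  rw [bind₁_monomial]
  refine (totalDegree_mul _ _).trans ?_
  rw [totalDegree_C, zero_add]
  refine (totalDegree_finsetProd _ _).trans ?_
  calc ∑ i ∈ d.support, (θ i ^ d i).totalDegree ≤ ∑ i ∈ d.support, d i :=
        Finset.sum_le_sum fun i _ => (totalDegree_pow _ _).trans
          (by simpa using Nat.mul_le_mul_left (d i) (hθ i))
    _ ≤ p.totalDegree := le_totalDegree hd

/-- Proof step of Thm. 3.8 (`totalDegree_linear_le`). [cite: AndrewsForbes2022, Thm. 3.8 (proof)] -/
theorem totalDegree_linear_le {R : Type*} [CommSemiring R] {κ : Type*} [Fintype κ] (c : κ → R) :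
    (∑ kl, C (c kl) * (X kl : MvPolynomial κ R)).totalDegree ≤ 1 := by
  refine (totalDegree_finsetSum _ _).trans (Finset.sup_le fun kl _ => ?_)
  refine (totalDegree_mul _ _).trans ?_
  rw [totalDegree_C, zero_add]
  by_cases h : Nontrivial R
  · exact (totalDegree_X (R := R) kl).le
  · have : Subsingleton R := not_nontrivial_iff_subsingleton.mp h
    rw [Subsingleton.elim (X kl : MvPolynomial κ R) 0, totalDegree_zero]; exact Nat.zero_le _

/-- Proof step of Thm. 3.8 (`totalDegree_extMat_le`). [cite: AndrewsForbes2022, Thm. 3.8 (proof)] -/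
theorem totalDegree_extMat_le {S : Type*} [CommRing S] {τ : Type*} {r : ℕ}
    (A : Matrix (Fin r) (Fin r) (MvPolynomial τ S)) (hA : ∀ i j, (A i j).totalDegree ≤ 1)
    (n m : ℕ) (i : Fin n) (j : Fin m) : (extMat A n m i j).totalDegree ≤ 1 := by
  rw [extMat_apply]
  split_ifs
  · exact hA _ _
  · rw [totalDegree_one]; exact Nat.zero_le _
  · rw [totalDegree_zero]; exact Nat.zero_le _

/-- Proof step of Thm. 3.8 (`polyOrdGE_zero_extMat`). [cite: AndrewsForbes2022, Thm. 3.8 (proof)] -/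
theorem polyOrdGE_zero_extMat {ι : Type*} {r : ℕ}
    (A : Matrix (Fin r) (Fin r) (MvPolynomial ι (LaurentSeries F)))
    (hA : ∀ i j, PolyOrdGE 0 (A i j)) (n m : ℕ) (i : Fin n) (j : Fin m) :
    PolyOrdGE 0 (extMat A n m i j) := by
  rw [extMat_apply]
  split_ifs
  · exact hA _ _
  · exact PolyOrdGE.one
  · exact PolyOrdGE.zero 0

end Helpers

end Theorem38

/-! #### Theorem 3.8 -/

set_option maxHeartbeats 1600000 in
open Theorem38 in
/-- **Discharge of `AndrewsForbes2022_thm_3_8`** (Theorem 3.8, characteristic zero), following the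
printed proof with Prop. 3.5, Lemma 3.6 and Lemma 3.7 of the tree; see the module docstring for the
architecture. [cite: AndrewsForbes2022, Thm. 3.8] -/
theorem AndrewsForbes2022_thm_3_8_holds : AndrewsForbes2022_thm_3_8 := by
  intro F _ _ n m r f hf hf0 h hh ι g hg
  classical
  obtain ⟨g', hg'abp, hg'g⟩ := hg
  -- `r = 0`: there is no ABP with `0` vertices
  rcases Nat.eq_zero_or_pos r with hr0 | hr0
  · subst hr0; exact absurd hg'abp (not_layeredABPComputes_zero g')
  -- `r > min(n,m)`: the ideal is `⊥`
  by_cases hrnm : r ≤ n ∧ r ≤ m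
  swap
  · exfalso; apply hf0
    have := hf
    rwa [detIdeal_eq_bot hrnm, Ideal.mem_bot] at this
  obtain ⟨hrn, hrm⟩ := hrnm
  -- Lemma 3.7 and Lemma 3.6
  obtain ⟨ĝ, D, hĝhom, hĝabp, hĝg'⟩ :=
    AndrewsForbes2022_lemma_3_7_holds (Polynomial F) ι r g' hg'abp
  obtain ⟨A, hAdeg, hAdet, hAmin⟩ :=
    AndrewsForbes2022_lemma_3_6_holds (Polynomial F) (Option ι) r ĝ hĝabp
  -- the constant case `D = 0`
  rcases Nat.eq_zero_or_pos D with hD0 | hDpos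
  · subst hD0
    have hĝC : ĝ = C (coeff 0 ĝ) := by
      by_cases hz : ĝ = 0
      · rw [hz]; simp
      · exact totalDegree_eq_zero_iff_eq_C.mp (hĝhom.totalDegree hz)
    have hg'C : g' = C (coeff 0 ĝ) := by
      rw [← hĝg']
      conv_lhs => rw [hĝC]
      rw [aeval_C, MvPolynomial.algebraMap_eq]
    have hgC : g = C ((coeff 0 ĝ).coeff 0) := by
      rw [← hg'g, hg'C, map_C, Polynomial.constantCoeff_apply]
    refine ⟨0, fun _ => 0, 0, algebraMap F (RatFunc F) ((coeff 0 ĝ).coeff 0),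
      fun _ => by rw [totalDegree_zero]; exact Nat.zero_le _, ?_⟩
    rw [hgC, map_C, map_zero, C_0, zero_mul, zero_add,
      show algebraMap (RatFunc F) (LaurentSeries F) (algebraMap F (RatFunc F) ((coeff 0 ĝ).coeff 0)) =
        algebraMap F (LaurentSeries F) ((coeff 0 ĝ).coeff 0) from by
          rw [← RingHom.comp_apply, algebraMap_ratFunc_comp_algebraMap], sub_self]
    exact PolyOrdGE.zero 1
  -- Proposition 3.5
  obtain ⟨c, q, α, σ, -, hα, hrσ, hσ, h35⟩ :=
    AndrewsForbes2022_prop_3_5_holds F n m r hr0 (le_min hrn hrm) f hf hf0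
  -- the number `t` of parts `≥ r`
  obtain ⟨t, ht⟩ : ∃ t : ℕ, t = Multiset.card (σ.filter fun s => r ≤ s) := ⟨_, rfl⟩
  have htpos : 0 < t := by
    rw [ht, Multiset.card_pos, Ne, Multiset.filter_eq_nil]
    intro hall
    have : σ.sup ≤ r - 1 := Multiset.sup_le.mpr fun b hb => by
      have := hall b hb; omega
    omega
  have htF : (t : F) ≠ 0 := Nat.cast_ne_zero.mpr htpos.ne'
  -- ring homomorphisms: old `ε ↦ ε^{D+1}`
  obtain ⟨φL, hφL⟩ : ∃ φL : F[X] →+* LaurentSeries F,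
      φL = (epsPow F D).comp (algebraMap F[X] (LaurentSeries F)) := ⟨_, rfl⟩
  obtain ⟨φK, hφK⟩ : ∃ φK : F[X] →+* RatFunc F,
      φK = (algebraMap F[X] (RatFunc F)).comp
        ((Polynomial.expand F (D + 1) : F[X] →ₐ[F] F[X]) : F[X] →+* F[X]) := ⟨_, rfl⟩
  obtain ⟨ψ, hψ⟩ : ∃ ψ : RatFunc F →+* LaurentSeries F,
      ψ = (epsPow F D).comp (algebraMap (RatFunc F) (LaurentSeries F)) := ⟨_, rfl⟩
  have hKL : (algebraMap (RatFunc F) (LaurentSeries F)).comp φK = φL := by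
    refine RingHom.ext fun p => ?_
    rw [hφK, hφL]
    simp only [RingHom.coe_comp, RingHom.coe_coe, Function.comp_apply]
    rw [← IsScalarTower.algebraMap_apply, algebraMap_expand]
  have hψF : ψ.comp (algebraMap F (RatFunc F)) = algebraMap F (LaurentSeries F) := by
    refine RingHom.ext fun a => ?_
    rw [hψ]
    simp only [RingHom.coe_comp, Function.comp_apply]
    rw [show algebraMap (RatFunc F) (LaurentSeries F) (algebraMap F (RatFunc F) a) =
      HahnSeries.C a from coe_ratFunc_algebraMap a, epsPow_C, algebraMap_laurentSeries_apply]
  -- the matrices `A` over `F(ε)` and `F((ε))` (old `ε` expanded)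
  obtain ⟨AK, hAK⟩ : ∃ AK : Matrix (Fin r) (Fin r) (MvPolynomial (Option ι) (RatFunc F)),
      AK = A.map (MvPolynomial.map φK) := ⟨_, rfl⟩
  obtain ⟨AL, hAL⟩ : ∃ AL : Matrix (Fin r) (Fin r) (MvPolynomial (Option ι) (LaurentSeries F)),
      AL = A.map (MvPolynomial.map φL) := ⟨_, rfl⟩
  have hAKL : AK.map (MvPolynomial.map (algebraMap (RatFunc F) (LaurentSeries F))) = AL := by
    rw [hAK, hAL, Matrix.map_map]
    congr 1
    funext p
    rw [Function.comp_apply, MvPolynomial.map_map, hKL]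
  have hALdet : AL.det = 1 + MvPolynomial.map φL ĝ := by
    rw [hAL, ← RingHom.mapMatrix_apply, ← RingHom.map_det, hAdet, map_add, map_one]
  have hALmin : ∀ (k : ℕ) (hk : k < r),
      (AL.submatrix (Fin.castLE hk.le) (Fin.castLE hk.le)).det = 1 := by
    intro k hk
    rw [hAL, Matrix.submatrix_map, ← RingHom.mapMatrix_apply, ← RingHom.map_det, hAmin k hk,
      map_one]
  -- the substitutions
  obtain ⟨θAK, hθAK⟩ : ∃ θ : Fin n × Fin m → MvPolynomial (Option ι) (RatFunc F),
      θ = fun kl => extMat AK n m kl.1 kl.2 := ⟨_, rfl⟩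
  obtain ⟨θAL, hθAL⟩ : ∃ θ : Fin n × Fin m → MvPolynomial (Option ι) (LaurentSeries F),
      θ = fun kl => extMat AL n m kl.1 kl.2 := ⟨_, rfl⟩
  obtain ⟨θεK, hθεK⟩ : ∃ θ : Option ι → MvPolynomial ι (RatFunc F),
      θ = fun o => C RatFunc.X * o.elim 1 X := ⟨_, rfl⟩
  obtain ⟨θεL, hθεL⟩ : ∃ θ : Option ι → MvPolynomial ι (LaurentSeries F),
      θ = fun o => C (HahnSeries.single 1 1) * o.elim 1 X := ⟨_, rfl⟩
  obtain ⟨ℓK, hℓK⟩ : ∃ ℓ : Fin n × Fin m → MvPolynomial (Fin n × Fin m) (RatFunc F),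
      ℓ = fun ij => ∑ kl, C (ratFuncExpand D (c ij kl)) * X kl := ⟨_, rfl⟩
  obtain ⟨ℓL, hℓL⟩ : ∃ ℓ : Fin n × Fin m → MvPolynomial (Fin n × Fin m) (LaurentSeries F),
      ℓ = fun ij => ∑ kl, C (ψ (c ij kl)) * X kl := ⟨_, rfl⟩
  have hθA : ∀ kl, MvPolynomial.map (algebraMap (RatFunc F) (LaurentSeries F)) (θAK kl) = θAL kl := by
    intro kl
    rw [hθAK, hθAL]
    show MvPolynomial.map _ (extMat AK n m kl.1 kl.2) = extMat AL n m kl.1 kl.2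
    rw [← Matrix.map_apply (f := MvPolynomial.map (algebraMap (RatFunc F) (LaurentSeries F)))
      (M := extMat AK n m), extMat_map, hAKL]
  have hθε : ∀ o, MvPolynomial.map (algebraMap (RatFunc F) (LaurentSeries F)) (θεK o) = θεL o := by
    intro o
    rw [hθεK, hθεL]
    cases o <;> simp [map_X]
  have hℓ : ∀ ij, MvPolynomial.map (algebraMap (RatFunc F) (LaurentSeries F)) (ℓK ij) = ℓL ij := by
    intro ij
    rw [hℓK, hℓL]
    simp only [map_sum, map_mul, map_C, map_X]
    refine Finset.sum_congr rfl fun kl _ => ?_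
    rw [show algebraMap (RatFunc F) (LaurentSeries F) (ratFuncExpand D (c ij kl)) = ψ (c ij kl) from
      by rw [hψ]; exact coe_ratFuncExpand D (c ij kl)]
  -- the circuit data
  obtain ⟨a, ha⟩ : ∃ a : Fin n × Fin m → MvPolynomial ι (RatFunc F),
      a = fun ij => MvPolynomial.bind₁ θεK (MvPolynomial.bind₁ θAK (ℓK ij)) := ⟨_, rfl⟩
  obtain ⟨abar, habar⟩ : ∃ abar : Fin n × Fin m → MvPolynomial ι (LaurentSeries F),
      abar = fun ij => MvPolynomial.bind₁ θεL (MvPolynomial.bind₁ θAL (ℓL ij)) := ⟨_, rfl⟩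
  have haL : ∀ ij, MvPolynomial.map (algebraMap (RatFunc F) (LaurentSeries F)) (a ij) = abar ij := by
    intro ij
    rw [ha, habar]
    simp only [map_bind₁, hθε, hθA, hℓ]
  -- orders of the pole of the bottom gates
  obtain ⟨e, he⟩ := IsOrdGE.exists_neg_nat_forall
    (fun p : (Fin n × Fin m) × (Fin n × Fin m) => ((c p.1 p.2 : RatFunc F) : LaurentSeries F))
  have hθAL0 : ∀ kl, PolyOrdGE 0 (θAL kl) := by
    intro kl
    rw [hθAL]
    refine polyOrdGE_zero_extMat AL (fun i j => ?_) n m kl.1 kl.2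
    rw [hAL, Matrix.map_apply, hφL, ← MvPolynomial.map_map]
    simpa using (polyOrdGE_zero_map_polynomial (A i j)).map_epsPow D
  have hθεL0 : ∀ o, PolyOrdGE 0 (θεL o) := by
    intro o
    have h1 : PolyOrdGE 1 (C (HahnSeries.single 1 (1 : F)) : MvPolynomial ι (LaurentSeries F)) :=
      PolyOrdGE.C (IsOrdGE.single 1 1)
    rw [hθεL]
    cases o with
    | none => simpa using h1.mono (by norm_num)
    | some i => simpa using (h1.mul (PolyOrdGE.X i)).mono (by norm_num)
  have habar_ord : ∀ ij, PolyOrdGE (-(((D + 1) * e : ℕ) : ℤ)) (abar ij) := by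
    intro ij
    rw [habar]
    refine PolyOrdGE.bind₁ (PolyOrdGE.bind₁ ?_ hθAL0) hθεL0
    rw [hℓL]
    refine PolyOrdGE.sum fun kl _ => ?_
    have hc : IsOrdGE (((D : ℤ) + 1) * (-(e : ℤ))) (ψ (c ij kl)) := by
      rw [hψ]; exact (he (ij, kl)).epsPow D
    have := (PolyOrdGE.C (σ := Fin n × Fin m) hc).mul (PolyOrdGE.X kl)
    convert this using 1
    push_cast; ring
  -- degrees of the bottom gates
  have hadeg : ∀ ij, (a ij).totalDegree ≤ 1 := by
    intro ij
    rw [ha]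
    refine (totalDegree_bind₁_le_of_le_one θεK (fun o => ?_) _).trans
      ((totalDegree_bind₁_le_of_le_one θAK (fun kl => ?_) _).trans ?_)
    · rw [hθεK]
      cases o with
      | none => simp [totalDegree_C]
      | some i =>
        refine (totalDegree_mul _ _).trans ?_
        simp [totalDegree_C, totalDegree_X]
    · rw [hθAK]
      refine totalDegree_extMat_le AK (fun i j => ?_) n m kl.1 kl.2
      rw [hAK, Matrix.map_apply]
      exact (totalDegree_map_le' _ _).trans (hAdeg i j)
    · rw [hℓK]; exact totalDegree_linear_le _
  -- the exponents and the top gate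
  obtain ⟨Q, hQ⟩ : ∃ Q : ℤ, Q = ((D : ℤ) + 1) * q := ⟨_, rfl⟩
  obtain ⟨fbar, hfbar⟩ : ∃ fbar : MvPolynomial (Fin n × Fin m) (LaurentSeries F),
      fbar = MvPolynomial.map (algebraMap F (LaurentSeries F)) f := ⟨_, rfl⟩
  obtain ⟨gbar, hgbar⟩ : ∃ gbar : MvPolynomial ι (LaurentSeries F),
      gbar = MvPolynomial.map (algebraMap F (LaurentSeries F)) g := ⟨_, rfl⟩
  obtain ⟨Dh, hDh⟩ : ∃ Dh : ℕ, Dh = (h - fbar).totalDegree := ⟨_, rfl⟩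
  obtain ⟨N, hN⟩ : ∃ N : ℕ, N = (Q + D).toNat + (D + 1) * e * Dh := ⟨_, rfl⟩
  obtain ⟨u, hu⟩ : ∃ u : RatFunc F,
      u = (RatFunc.X ^ (Q + D) * algebraMap F (RatFunc F) (α * t))⁻¹ := ⟨_, rfl⟩
  obtain ⟨v, hv⟩ : ∃ v : RatFunc F,
      v = -(RatFunc.X ^ (D : ℤ) * algebraMap F (RatFunc F) (t : F))⁻¹ := ⟨_, rfl⟩
  refine ⟨N, a, u, v, hadeg, ?_⟩
  -- images of `u`, `v` in `F((ε))`
  obtain ⟨w, hw⟩ : ∃ w : LaurentSeries F, w = HahnSeries.single (-(D : ℤ)) ((t : F)⁻¹) := ⟨_, rfl⟩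
  have hcoeX : algebraMap (RatFunc F) (LaurentSeries F) RatFunc.X = HahnSeries.single 1 1 :=
    RatFunc.coe_X
  have hubar : algebraMap (RatFunc F) (LaurentSeries F) u =
      HahnSeries.single (-(Q + D)) ((α * t : F)⁻¹) := by
    rw [hu, map_inv₀, map_mul, map_zpow₀, hcoeX, ← RatFunc.single_zpow,
      show algebraMap (RatFunc F) (LaurentSeries F) (algebraMap F (RatFunc F) (α * t)) =
        HahnSeries.C (α * t) from coe_ratFunc_algebraMap _, HahnSeries.C_apply,
      HahnSeries.single_mul_single, add_zero, one_mul, HahnSeries.inv_single]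
  have hvbar : algebraMap (RatFunc F) (LaurentSeries F) v = -w := by
    rw [hv, map_neg, map_inv₀, map_mul, map_zpow₀, hcoeX, ← RatFunc.single_zpow,
      show algebraMap (RatFunc F) (LaurentSeries F) (algebraMap F (RatFunc F) (t : F)) =
        HahnSeries.C (t : F) from coe_ratFunc_algebraMap _, HahnSeries.C_apply,
      HahnSeries.single_mul_single, add_zero, one_mul, HahnSeries.inv_single, hw]
  -- Step 1: the identity of Prop. 3.5, pushed to `F((ε))` with old `ε` expanded
  obtain ⟨ErrK, hErrK⟩ : ∃ ErrK : MvPolynomial (Fin n × Fin m) (RatFunc F),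
      ErrK = MvPolynomial.aeval (fun ij : Fin n × Fin m =>
        ∑ kl : Fin n × Fin m, C (c ij kl) * X kl) f -
      C (RatFunc.X ^ q * algebraMap F (RatFunc F) α) *
        MvPolynomial.map (algebraMap F (RatFunc F)) (kBideterminant F n m σ) := ⟨_, rfl⟩
  have hErr : PolyOrdGE (((D : ℤ) + 1) * (q + 1)) (MvPolynomial.map ψ ErrK) := by
    intro d
    rw [MvPolynomial.coeff_map, hψ, RingHom.comp_apply]
    have := (isBigOEps_iff_isOrdGE _ _).mp (h35 d)
    rw [← hErrK] at this
    exact this.epsPow D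
  have hfℓ : MvPolynomial.map ψ (MvPolynomial.aeval (fun ij : Fin n × Fin m =>
      ∑ kl : Fin n × Fin m, C (c ij kl) * X kl) f) = MvPolynomial.bind₁ ℓL fbar := by
    have hfun : (fun i : Fin n × Fin m => MvPolynomial.map ψ
        (∑ kl : Fin n × Fin m, C (c i kl) * (X kl : MvPolynomial _ (RatFunc F)))) = ℓL := by
      rw [hℓL]; funext ij; simp only [map_sum, map_mul, map_C, map_X]
    rw [← MvPolynomial.aeval_map_algebraMap (RatFunc F), MvPolynomial.aeval_eq_bind₁, map_bind₁,
      MvPolynomial.map_map, hψF, hfbar, hfun]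
  have hKσ : MvPolynomial.map ψ (C (RatFunc.X ^ q * algebraMap F (RatFunc F) α) *
      MvPolynomial.map (algebraMap F (RatFunc F)) (kBideterminant F n m σ)) =
      C (HahnSeries.single Q α) * kBideterminant (LaurentSeries F) n m σ := by
    rw [map_mul, map_C, MvPolynomial.map_map, hψF, map_kBideterminant]
    congr 2
    rw [hψ, RingHom.comp_apply, map_mul, map_zpow₀, hcoeX, ← RatFunc.single_zpow,
      show algebraMap (RatFunc F) (LaurentSeries F) (algebraMap F (RatFunc F) α) =
        HahnSeries.C α from coe_ratFunc_algebraMap _, map_mul, epsPow_single, epsPow_C,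
      HahnSeries.C_apply, HahnSeries.single_mul_single, hQ]
    simp
  have hI1 : MvPolynomial.bind₁ ℓL fbar =
      C (HahnSeries.single Q α) * kBideterminant (LaurentSeries F) n m σ +
        MvPolynomial.map ψ ErrK := by
    rw [← hfℓ, ← hKσ, hErrK, map_sub]; ring
  -- Step 2: substitute `X ↦ A ⊕ I`
  have hI2 : MvPolynomial.bind₁ θAL (MvPolynomial.bind₁ ℓL fbar) =
      C (HahnSeries.single Q α) * (1 + MvPolynomial.map φL ĝ) ^ t +
        MvPolynomial.bind₁ θAL (MvPolynomial.map ψ ErrK) := by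
    rw [hI1, map_add, map_mul, bind₁_C_right, hθAL, bind₁_kBideterminant_extMat AL hALmin σ hσ,
      hALdet, ht]
  have hE2 : PolyOrdGE (((D : ℤ) + 1) * (q + 1))
      (MvPolynomial.bind₁ θAL (MvPolynomial.map ψ ErrK)) := hErr.bind₁ hθAL0
  -- Step 3: substitute `y ↦ ε y`, `z ↦ ε`
  obtain ⟨G, hG⟩ : ∃ G : MvPolynomial ι (LaurentSeries F), G = MvPolynomial.map φL g' := ⟨_, rfl⟩
  have hGeq : MvPolynomial.bind₁ (fun o : Option ι => o.elim 1 X) (MvPolynomial.map φL ĝ) = G := by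
    have hfun : (fun o : Option ι => MvPolynomial.map φL (o.elim 1 X)) =
        fun o : Option ι => (o.elim 1 X : MvPolynomial ι (LaurentSeries F)) :=
      funext fun o => by cases o <;> simp [map_X]
    rw [hG, ← hĝg', MvPolynomial.aeval_eq_bind₁, map_bind₁, hfun]
  have hscale : MvPolynomial.bind₁ θεL (MvPolynomial.map φL ĝ) =
      C (HahnSeries.single (D : ℤ) (1 : F)) * G := by
    rw [hθεL, bind₁_C_mul_of_isHomogeneous (hĝhom.map φL) (HahnSeries.single 1 1)
      (fun o : Option ι => o.elim 1 X), hGeq, HahnSeries.single_pow]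
    simp
  have habar3 : MvPolynomial.bind₁ abar fbar =
      MvPolynomial.bind₁ θεL (MvPolynomial.bind₁ θAL (MvPolynomial.bind₁ ℓL fbar)) := by
    rw [habar]; simp only [bind₁_bind₁]
  have hI3 : MvPolynomial.bind₁ abar fbar =
      C (HahnSeries.single Q α) * (1 + C (HahnSeries.single (D : ℤ) (1 : F)) * G) ^ t +
        MvPolynomial.bind₁ θεL (MvPolynomial.bind₁ θAL (MvPolynomial.map ψ ErrK)) := by
    rw [habar3, hI2, map_add, map_mul, bind₁_C_right, map_pow, map_add, map_one, hscale]
  have hE3 : PolyOrdGE (((D : ℤ) + 1) * (q + 1))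
      (MvPolynomial.bind₁ θεL (MvPolynomial.bind₁ θAL (MvPolynomial.map ψ ErrK))) :=
    hE2.bind₁ hθεL0
  -- Step 4: `G = g + O(ε^{D+1})`, `G = O(1)`
  have hG0 : PolyOrdGE 0 G := by
    rw [hG, hφL, ← MvPolynomial.map_map]
    simpa using (polyOrdGE_zero_map_polynomial g').map_epsPow D
  have hE4 : PolyOrdGE ((D : ℤ) + 1) (G - gbar) := by
    have h1 := (polyOrdGE_one_map_polynomial_sub g').map_epsPow D
    rw [hg'g, map_sub, map_epsPow_map_algebraMap, MvPolynomial.map_map, ← hφL, ← hG, ← hgbar,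
      mul_one] at h1
    exact h1
  -- Step 5: binomial expansion
  obtain ⟨W, hW⟩ := add_pow_eq_remainder (C (HahnSeries.single (D : ℤ) (1 : F)) * G) t
  have hW0 : PolyOrdGE 0 ((W.map (Nat.castRingHom _)).eval
      (C (HahnSeries.single (D : ℤ) (1 : F)) * G)) :=
    polyOrdGE_zero_eval_natPoly W (((PolyOrdGE.C (IsOrdGE.single _ _)).mul hG0).mono (by omega))
  -- Step 6: the `f`-oracle circuit computes `g + O(ε)`
  have hs1 : HahnSeries.single (-(Q + D)) ((α * t : F)⁻¹) * HahnSeries.single Q α = w := by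
    rw [HahnSeries.single_mul_single, hw]
    congr 1
    · ring
    · field_simp
  have hs3 : w * (t : LaurentSeries F) * HahnSeries.single (D : ℤ) (1 : F) = 1 := by
    rw [hw, ← map_natCast (HahnSeries.C : F →+* LaurentSeries F) t, HahnSeries.C_apply,
      HahnSeries.single_mul_single, HahnSeries.single_mul_single, ← HahnSeries.single_zero_one]
    congr 1
    · ring
    · field_simp
  have hmain : PolyOrdGE 1
      (C (algebraMap (RatFunc F) (LaurentSeries F) u) * MvPolynomial.bind₁ abar fbar +
        C (algebraMap (RatFunc F) (LaurentSeries F) v) - gbar) := by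
    rw [hubar, hvbar, hI3, hW]
    have key : C (HahnSeries.single (-(Q + D)) ((α * t : F)⁻¹)) *
        (C (HahnSeries.single Q α) * (1 + (t : MvPolynomial ι (LaurentSeries F)) *
          (C (HahnSeries.single (D : ℤ) (1 : F)) * G) +
          (C (HahnSeries.single (D : ℤ) (1 : F)) * G) ^ 2 *
            (W.map (Nat.castRingHom _)).eval (C (HahnSeries.single (D : ℤ) (1 : F)) * G)) +
          MvPolynomial.bind₁ θεL (MvPolynomial.bind₁ θAL (MvPolynomial.map ψ ErrK))) +
        C (-w) - gbar =
      (C (HahnSeries.single (-(Q + D)) ((α * t : F)⁻¹) * HahnSeries.single Q α) - C w) +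
      ((C (HahnSeries.single (-(Q + D)) ((α * t : F)⁻¹) * HahnSeries.single Q α *
          (t : LaurentSeries F) * HahnSeries.single (D : ℤ) (1 : F)) - 1) * gbar +
        C (HahnSeries.single (-(Q + D)) ((α * t : F)⁻¹) * HahnSeries.single Q α *
          (t : LaurentSeries F) * HahnSeries.single (D : ℤ) (1 : F)) * (G - gbar)) +
      C (HahnSeries.single (-(Q + D)) ((α * t : F)⁻¹) * HahnSeries.single Q α *
          HahnSeries.single (D : ℤ) (1 : F) ^ 2) *
        (G ^ 2 * (W.map (Nat.castRingHom _)).eval (C (HahnSeries.single (D : ℤ) (1 : F)) * G)) +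
      C (HahnSeries.single (-(Q + D)) ((α * t : F)⁻¹)) *
        MvPolynomial.bind₁ θεL (MvPolynomial.bind₁ θAL (MvPolynomial.map ψ ErrK)) := by
      simp only [map_mul, map_neg, map_pow,
        ← map_natCast (C : LaurentSeries F →+* MvPolynomial ι (LaurentSeries F)) t]
      ring
    rw [key]
    refine ((PolyOrdGE.add ?_ ?_).add ?_).add ?_
    · rw [hs1, sub_self]; exact PolyOrdGE.zero 1
    · rw [hs1, hs3, C_1, sub_self, zero_mul, zero_add, one_mul]
      exact hE4.mono (by omega)
    · have hord : IsOrdGE (D : ℤ) (HahnSeries.single (-(Q + D)) ((α * t : F)⁻¹) *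
          HahnSeries.single Q α * HahnSeries.single (D : ℤ) (1 : F) ^ 2) := by
        rw [hs1, hw, sq, HahnSeries.single_mul_single, HahnSeries.single_mul_single]
        convert IsOrdGE.single (F := F) _ _ using 2; ring
      have := (PolyOrdGE.C hord).mul ((hG0.pow 2).mul hW0)
      exact this.mono (by simp only [add_zero]; exact_mod_cast hDpos)
    · have hord : IsOrdGE (-(Q + D)) (HahnSeries.single (-(Q + D)) ((α * t : F)⁻¹)) :=
        IsOrdGE.single _ _
      have := (PolyOrdGE.C hord).mul hE3
      have heq : -(Q + (D : ℤ)) + ((D : ℤ) + 1) * (q + 1) = 1 := by rw [hQ]; ring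
      exact this.mono heq.symm.le
  -- Step 7: replace the `f`-oracle by the `h(·, ε^{N+1})`-oracle
  have hdiff : PolyOrdGE 1 (C (algebraMap (RatFunc F) (LaurentSeries F) u) *
      MvPolynomial.bind₁ abar (MvPolynomial.map (epsPow F N) h - fbar)) := by
    have hsub : MvPolynomial.map (epsPow F N) h - fbar = MvPolynomial.map (epsPow F N) (h - fbar) := by
      rw [map_sub, hfbar, map_epsPow_map_algebraMap]
    have h1 : PolyOrdGE (((N : ℤ) + 1) * 1) (MvPolynomial.map (epsPow F N) (h - fbar)) :=
      (hfbar ▸ hh).map_epsPow N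
    have hdeg : (MvPolynomial.map (epsPow F N) (h - fbar)).totalDegree ≤ Dh := by
      rw [hDh]; exact totalDegree_map_le' _ _
    have h2 := h1.bind₁_of_totalDegree_le hdeg habar_ord
    have hord : IsOrdGE (-(Q + D)) (algebraMap (RatFunc F) (LaurentSeries F) u) := by
      rw [hubar]; exact IsOrdGE.single _ _
    rw [hsub]
    refine ((PolyOrdGE.C hord).mul h2).mono ?_
    have : Q + (D : ℤ) ≤ ((Q + D).toNat : ℤ) := Int.self_le_toNat _
    rw [hN]; push_cast; nlinarith
  -- conclusion
  have hfin := hmain.add hdiff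
  have hfun : (fun x => MvPolynomial.map (algebraMap (RatFunc F) (LaurentSeries F)) (a x)) = abar :=
    funext haL
  rw [MvPolynomial.aeval_eq_bind₁, hfun, ← hgbar]
  have heq : C (algebraMap (RatFunc F) (LaurentSeries F) u) *
        MvPolynomial.bind₁ abar (MvPolynomial.map (epsPow F N) h) +
      C (algebraMap (RatFunc F) (LaurentSeries F) v) - gbar =
      C (algebraMap (RatFunc F) (LaurentSeries F) u) * MvPolynomial.bind₁ abar fbar +
        C (algebraMap (RatFunc F) (LaurentSeries F) v) - gbar +
      C (algebraMap (RatFunc F) (LaurentSeries F) u) *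
        MvPolynomial.bind₁ abar (MvPolynomial.map (epsPow F N) h - fbar) := by
    rw [map_sub]; ring
  rw [heq]
  exact hfin

end Literature.Computability.AlgebraicComplexity
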